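import Mathlib
import HarnessLib
import Summits.HubbardSuperconductivity.HubbardSuperconductivity.Theorems.KLProgrammeKLRegimeEngineScaleOneSrcPackageWDoors
import Summits.HubbardSuperconductivity.HubbardSuperconductivity.Theorems.KLProgrammeKLRegimeEngineScaleCutoffAlphaW
import Summits.HubbardSuperconductivity.HubbardSuperconductivity.Theorems.KLProgrammeKLRegimeEngineTowerLevZBaseOfWgridStep

/-!
# Route `KLProgramme` — K3 VL child (stmt-HubbardSuperconductivity-23356), atom HUV-W, input (a) of LEVEL 1: the partition function at the cutoff
# `Λ₁ = e₀/4` does not vanish, `Z^K_{Λ₁} ≠ 0`, for EVERY admissible frame under the level-`0` doors (cell gate-hubbard-kl, seat p3 g21)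

k3c3-p2's `hubbardEffPartitionFnCT_klScale_ne_zero_of_wgridStep` (…TowerLevZBaseOfWgridStep) derives `Z^K_{Λ_d} ≠ 0` from the base binders of ONE weighted
grid step at `Λ_d`: the Gram constant, the `gridLabelWt`-weighted rows / columns `α_w` and the smallness `θ_w < 1`.  At `d = 1` these are exactly the inputs
p3 g20 assembled for `kernelNormsWtAt_one_of_bounds` / `srcPinnedSumW_one_of_bounds`: `isGramBoundedR_scaleOneCutoff_of_frameOK_sharp` (`κ₁ = √(2(7+6047)) + √6047`),
`rowSum_/colSum_scaleCutoff_gridLabelWt_le_X5 1` (`α_w = 4MĀ/β`), `thetaW_cutoff_le_half` (`16e⁵Āk̄K ≤ 1`, `64e⁹κ₁²Ā|U| ≤ 1`).  Hence: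

* **`partitionFn_scaleOne_ne_zero_of_bounds`** — `Z^K_{Λ₁} ≠ 0` under `FrameOK R U Nsc μ K`, `R.WF`, `0 < U`, `|U| ≤ 1`, `klBetaMin ≤ β`, `klEngL₃/klEngM₃`,
  a bracket majorant `Ā > 0`, a frame-size majorant `k̄K` and the two smallness conditions;
* **`exists_partitionFn_scaleOne_ne_zero`** — packaged with the level-`0` doors: `∀ P R, WF → ∃ c₀ > 0, ∀ c ≤ c₀, ∃ U₀ > 0, ∀ μ U β (regime), ∀ L M ≥
  (klEngL₃, klEngM₃), ∀ K, FrameOK R U (nScales β) μ K → Z^K_{Λ₁} ≠ 0` — this discharges hypothesis (a) of `exists_sourceProfilesAtLevF_srcWindow_one`.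

Everything is proved; no definitions, no sorry.  Nothing asserts HUV, any stub, VL, K3 or superconductivity.
[cite: BenfattoGiulianiMastropietro2006, §2.7 (2.77)–(2.81); cite: GawedzkiKupiainen1985GrossNeveu, §3]
-/

noncomputable section

namespace Summit.HubbardSuperconductivity.HubbardSuperconductivity.Theorems.EngineV8

set_option linter.dupNamespace false -- summit = problem name (single-conjunct summit), D-0017

open Real Finset Literature.MathematicalPhysics.QuantumLattice Literature.Probability.LatticeModels Literature.Probability.LatticeModels.BattleFederbush
open Summit.HubbardSuperconductivity.HubbardSuperconductivity.Theorems.KLRegimeSplit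
open Summit.HubbardSuperconductivity.HubbardSuperconductivity.Theorems.KLProgrammeLegKernels
open Summit.HubbardSuperconductivity.HubbardSuperconductivity.Theorems.ScaleZeroDecay

variable {L M : ℕ} [NeZero L] [NeZero M]

/-- **`Z^K_{Λ₁} ≠ 0` for every admissible frame, from the level-`0` one-step data** (Gram `κ₁`, `α_w = 4MĀ/β`, `θ_w ≤ 1/2`).
[cite: BenfattoGiulianiMastropietro2006, §2.7 (2.77)–(2.81)] -/
theorem partitionFn_scaleOne_ne_zero_of_bounds {R : RenConsts} {U μ β : ℝ} {Nsc : ℕ} {K : TrigPolyC4v} (hK : FrameOK R U Nsc μ K) (hR : R.WF)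
    (hU : 0 < U) (hU1 : |U| ≤ 1) (hβ : klBetaMin ≤ β) (hL : klEngL₃ β U ≤ L) (hM : klEngM₃ β U L ≤ M)
    {Abar : ℝ} (hAbar0 : 0 < Abar)
    (hAbar : (14 * Real.sqrt ((1 / 2 + 12 / klScale klE0 1) *
            (2 / klScale klE0 1 + 128 * Real.pi ^ 4 * (4 * (1110 : ℝ) + 6 * (32 / 3) + 2) ^ 2 / klScale klE0 1 +
              2 * Real.pi ^ 5 * (4 * (1110 : ℝ) + 6 * (32 / 3) + 2) ^ 2 / klScale klE0 1 ^ 2 + 1 +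
              Real.pi ^ 4 * ((7 : ℝ) ^ 2 * (4 * (1110 : ℝ) + 6 * (32 / 3) + 2) * (2 / klScale klE0 1) + 7 * (2 * (32 / 3) + 1)) ^ 2 /
                klScale klE0 1 ^ 3))) + uvTimeMomentConst (klScale klE0 1) 7 32 +
        2 * (uvSpaceMomentConst (klScale klE0 1) 1 (uvPieceSq (klScale klE0 1) (uvBaseQ klCutoffX5 (klScale klE0 1) 4) (uvBaseQ' klCutoffX5 (klScale klE0 1) 4)) +
          (1 / 4 * Real.sqrt (216 * (1 / klScale klE0 1 + 1 / 2)) *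
              ∑ e : Fin 2 × Fin 2, (uvLinV (klScale klE0 1) (1 + (e.1 : ℕ) + (e.2 : ℕ)) *
                  (klCutoffX5 * ((1 + ((e.1 : ℕ) + (e.2 : ℕ)) + 2).factorial : ℝ) * (4 / klScale klE0 1) ^ (1 + ((e.1 : ℕ) + (e.2 : ℕ)) + 1)) +
                uvLinD (klScale klE0 1) (1 + (e.1 : ℕ) + (e.2 : ℕ)) *
                  (klCutoffX5 * ((1 + ((e.1 : ℕ) + (e.2 : ℕ)) + 3).factorial : ℝ) * (4 / klScale klE0 1) ^ (1 + ((e.1 : ℕ) + (e.2 : ℕ)) + 2)))) *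
            (4608 * (1 + R.Gfr 0 + R.Gfr 1 + R.Gfr 2 + R.Gfr 3) ^ 4 * (((Nsc : ℝ) + 1) * U ^ 2 + 2 * |U|))) ≤ Abar)
    {kKbar : ℝ}
    (hkKbar : klKappaFrameC R * |U| + 2 * (((Nsc : ℝ) + 1) * U ^ 2 *
        (6 * (Real.pi * R.Gfr 1 / 2 + Real.pi ^ 2 * R.Gfr 2 / (2 * Real.sqrt 2) + Real.pi ^ 3 * R.Gfr 3 / 8))) ≤ kKbar)
    (hθ1 : 16 * Real.exp 1 ^ 5 * Abar * kKbar ≤ 1) (hθ2 : 64 * Real.exp 1 ^ 9 * (Real.sqrt (2 * (7 + 6047)) + Real.sqrt 6047) ^ 2 * Abar * |U| ≤ 1) :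
    hubbardEffPartitionFnCT L M β U μ 0 K (klScale klE0 1) ≠ 0 := by
  haveI : NeZero (2 * (2 * M)) := ⟨by have := NeZero.ne M; omega⟩
  have hβ0 : 0 < β := beta_pos_of_klBetaMin_le hβ
  have hβ128 : (128 : ℝ) ≤ β := by simpa [klBetaMin] using hβ
  obtain ⟨-, hβL, -, hβM, -, -⟩ := scaleZero_regime_sizes hβ hL hM
  have hMpos : (0 : ℝ) < M := by linarith only [hβ128, hβM]
  have hN4 : (((2 * (2 * M) : ℕ) : ℝ)) = 4 * M := by push_cast; ring
  have hκ0 : 0 < (Real.sqrt (2 * (7 + 6047)) + Real.sqrt 6047) :=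
    add_pos_of_pos_of_nonneg (Real.sqrt_pos.2 (by norm_num)) (Real.sqrt_nonneg _)
  have hGB := isGramBoundedR_scaleOneCutoff_of_frameOK_sharp (L := L) (M := M) hK hβ hβL
  have hAw : 0 < 4 * M * Abar / β := by positivity
  have hrow : ∀ X : GridLeg (GridPoint L (2 * (2 * M))), ∑ Y : GridLeg (GridPoint L (2 * (2 * M))),
      ‖((hubbardGridSub L M β (2 * (2 * M))).transpose * hubbardCovAboveCT L M β μ 0 K (klScale klE0 1) *
          hubbardGridSub L M β (2 * (2 * M))) X Y‖ * gridLabelWt L (2 * (2 * M)) β {gridLegPos X, gridLegPos Y} ≤ 4 * M * Abar / β := by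
    intro X
    refine (rowSum_scaleCutoff_gridLabelWt_le_X5 (L := L) (M := M) 1 hK hR hU1 hβ hL hM X).trans ?_
    rw [hN4]
    have : (4 : ℝ) * M / β * _ ≤ 4 * M / β * Abar := mul_le_mul_of_nonneg_left hAbar (by positivity)
    calc _ ≤ 4 * M / β * Abar := this
      _ = 4 * M * Abar / β := by ring
  have hcol : ∀ Y : GridLeg (GridPoint L (2 * (2 * M))), ∑ X : GridLeg (GridPoint L (2 * (2 * M))),
      ‖((hubbardGridSub L M β (2 * (2 * M))).transpose * hubbardCovAboveCT L M β μ 0 K (klScale klE0 1) *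
          hubbardGridSub L M β (2 * (2 * M))) X Y‖ * gridLabelWt L (2 * (2 * M)) β {gridLegPos X, gridLegPos Y} ≤ 4 * M * Abar / β := by
    intro Y
    refine (colSum_scaleCutoff_gridLabelWt_le_X5 (L := L) (M := M) 1 hK hR hU1 hβ hL hM Y).trans ?_
    rw [hN4]
    have : (4 : ℝ) * M / β * _ ≤ 4 * M / β * Abar := mul_le_mul_of_nonneg_left hAbar (by positivity)
    calc _ ≤ 4 * M / β * Abar := this
      _ = 4 * M * Abar / β := by ring
  have hkK : ∑ z : TorusSite 2 L, ‖framePosKernel L K z‖ * (1 + torusSiteDist z 0) ≤ kKbar :=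
    (frameKernel_weightedL1_le (L := L) hR hU.ne' hU1 hK).trans hkKbar
  have hθ := thetaW_cutoff_le_half (L := L) (M := M) hβ0 hκ0 K hAbar0.le hkK hθ1 hθ2
  exact hubbardEffPartitionFnCT_klScale_ne_zero_of_wgridStep (L := L) (M := M) hβ0 U μ K 1 hκ0 hGB hAw hrow hcol hκ0
    (lt_of_le_of_lt hθ (by norm_num))

/-- **`Z^K_{Λ₁} ≠ 0` for every admissible frame, PACKAGED with the level-`0` doors** (the same door construction as
`exists_srcPinnedSumW_one_klSrcBudget`: `Ā := D₁·(1+ΣGfr)⁴`, `k̄K := klE4KapF R·|U| + 2(c/log 4)·klE4Mom R`, product doors on `c` and `U`).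
[cite: BenfattoGiulianiMastropietro2006, §2.7 (2.77)–(2.81)] -/
theorem exists_partitionFn_scaleOne_ne_zero (P : SplitConsts) (R : RenConsts) (hR : R.WF2) :
    ∃ c₀ : ℝ, 0 < c₀ ∧ ∀ c : ℝ, 0 < c → c ≤ c₀ → ∃ U₀ : ℝ, 0 < U₀ ∧
      ∀ μ ∈ klWindowC, ∀ U : ℝ, 0 < U → U ≤ U₀ → ∀ β : ℝ, klBetaMin ≤ β → β ≤ Real.exp (c / U ^ 2) →
        ∀ (L M : ℕ) [NeZero L] [NeZero M], klEngL₃ β U ≤ L → klEngM₃ β U L ≤ M →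
          ∀ K : TrigPolyC4v, FrameOK R U (nScales β) μ K → hubbardEffPartitionFnCT L M β U μ 0 K (klScale klE0 1) ≠ 0 := by
  obtain ⟨D₁, hD₁, hbr⟩ := exists_abarOne_le
  have hRwf : R.WF := hR.wf
  have hG : ∀ j, 0 ≤ R.Gfr j := hRwf.2.2
  have he1 : 1 ≤ Real.exp 1 := Real.one_le_exp (by norm_num)
  have h4 : 0 < Real.log 4 := Real.log_pos (by norm_num)
  have hKF := one_le_klE4KapF R
  set g : ℝ := (1 + R.Gfr 0 + R.Gfr 1 + R.Gfr 2 + R.Gfr 3) ^ 4 with hg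
  have hg1 : 1 ≤ g := by
    rw [hg]
    have : (1 : ℝ) ≤ 1 + R.Gfr 0 + R.Gfr 1 + R.Gfr 2 + R.Gfr 3 := by linarith [hG 0, hG 1, hG 2, hG 3]
    exact one_le_pow₀ this
  set Abar : ℝ := D₁ * g with hAbarD
  have hAbar1 : 1 ≤ Abar := one_le_mul_of_one_le_of_one_le hD₁ hg1
  have hAbarpos : 0 < Abar := lt_of_lt_of_le one_pos hAbar1
  set κ₁ : ℝ := Real.sqrt (2 * (7 + 6047)) + Real.sqrt 6047 with hκ₁
  have hκ₁1 : 1 ≤ κ₁ ^ 2 := by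
    have h1 : (1 : ℝ) ≤ Real.sqrt (2 * (7 + 6047)) := by
      rw [show (1 : ℝ) = Real.sqrt 1 by simp]; exact Real.sqrt_le_sqrt (by norm_num)
    have h2 : 0 ≤ Real.sqrt 6047 := Real.sqrt_nonneg _
    have h3 : (1 : ℝ) ≤ κ₁ := by rw [hκ₁]; linarith
    exact one_le_pow₀ h3
  have hκ₁pos : 0 < κ₁ := by
    rw [hκ₁]; exact add_pos_of_pos_of_nonneg (Real.sqrt_pos.2 (by norm_num)) (Real.sqrt_nonneg _)
  have hKFpos : 0 < klE4KapF R := lt_of_lt_of_le one_pos hKF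
  have hMom1 : 0 < klE4Mom R + 1 := by have := klE4Mom_nonneg R; linarith
  -- the c-door
  refine ⟨min (klEngC₃6 P R) (Real.log 4 / (128 * Real.exp 1 ^ 5 * Abar * (klE4Mom R + 1))), lt_min (klEngC₃6_pos P R) (by positivity),
    fun c hc hcc₀ => ?_⟩
  have hc₆ : c ≤ klEngC₃6 P R := hcc₀.trans (min_le_left _ _)
  have hcd' : c ≤ Real.log 4 / (128 * Real.exp 1 ^ 5 * Abar * (klE4Mom R + 1)) := hcc₀.trans (min_le_right _ _)
  have hcd : 128 * Real.exp 1 ^ 5 * Abar * (klE4Mom R + 1) * (c / Real.log 4) ≤ 1 := by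
    have hden : 0 < 128 * Real.exp 1 ^ 5 * Abar * (klE4Mom R + 1) := by positivity
    rw [le_div_iff₀ hden] at hcd'
    rw [show 128 * Real.exp 1 ^ 5 * Abar * (klE4Mom R + 1) * (c / Real.log 4) =
      128 * Real.exp 1 ^ 5 * Abar * (klE4Mom R + 1) * c / Real.log 4 by ring, div_le_one h4]
    linarith
  -- the U-door
  refine ⟨min (klEngU₀6 P R c) (1 / (128 * Real.exp 1 ^ 9 * κ₁ ^ 2 * Abar * klE4KapF R)), lt_min (klEngU₀6_pos P R c) (by positivity),
    fun μ hμ U hU hUU₀ β hβ hβc L M _ _ hL hM K hK => ?_⟩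
  have hU₆ : U ≤ klEngU₀6 P R c := hUU₀.trans (min_le_left _ _)
  have hUd' : U ≤ 1 / (128 * Real.exp 1 ^ 9 * κ₁ ^ 2 * Abar * klE4KapF R) := hUU₀.trans (min_le_right _ _)
  have hUd : 128 * Real.exp 1 ^ 9 * κ₁ ^ 2 * Abar * klE4KapF R * U ≤ 1 := by
    have hden : 0 < 128 * Real.exp 1 ^ 9 * κ₁ ^ 2 * Abar * klE4KapF R := by positivity
    rw [le_div_iff₀ hden] at hUd'; linarith
  obtain ⟨hθ1, hθ2⟩ := thetaW_smallness_of_le (cl := c / Real.log 4) he1 hκ₁1 hAbarpos.le hKF hU (div_nonneg hc.le h4.le) hUd hcd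
  have hU₀3 : U ≤ klEngU₀3 P R c := hU₆.trans (klEngU₀6_le_klEngU₀3 P R c)
  have hU1 : |U| ≤ 1 := abs_le_one_of_le_klEngU₀3 hU hU₀3
  have hcD : c ≤ klE4C₃ R := hc₆.trans (klEngC₃6_le_klE4C₃ P R)
  have hN := nScales_succ_mul_sq_le (U := U) hc.le hβ hβc
  have hhalf := div_log_four_le_half_of_door hcD
  have hAbar := (hbr R U (nScales β) hRwf hU1 (hN.trans hhalf)).trans (le_of_eq hAbarD.symm)
  exact partitionFn_scaleOne_ne_zero_of_bounds hK hRwf hU hU1 hβ hL hM hAbarpos hAbar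
    (kKbar := klE4KapF R * |U| + 2 * (c / Real.log 4) * klE4Mom R) (kKbar_le hRwf hN) hθ1 hθ2

end Summit.HubbardSuperconductivity.HubbardSuperconductivity.Theorems.EngineV8

end
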